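import Mathlib.LinearAlgebra.Prod
import Mathlib.LinearAlgebra.TensorProduct.Basic
import Mathlib.RingTheory.Flat.Basic
import Mathlib.LinearAlgebra.Basis.VectorSpace
import Mathlib.Tactic.Ring
import Mathlib.Tactic.NormNum
import HarnessLib

/-!
# The weak criterion on products of abelian varieties: Question 11.4″(a) fails in every dimension ≥ 3

Family `hodge`, layer `Literature/AlgebraicGeometry/HodgeTheory`. Ladder note `papers/HodgeConjecture/hodge-weil-ladder`,
section "Question 11.4 on abelian varieties, V: products" (generation 11; pen-and-paper statement refereed in-cell, kernel-checked
linear algebra below). Companion of `SemiregularityWeakCriterionAbelianCounterexample.lean` (= [S]: on the Jacobian `J` of a general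
bielliptic genus-3 curve the ideal sheaf `E = I_{F_e}` of a general member of the bielliptic pencil satisfies Markman's weak criterion
(W) and (W_T), is not semiregular, and has NO flat deformation — after any finite base change, twisted or not — along a general arc
`B` of the Hodge locus `NL([F_e])`), and of the template "Corollary P" of `SemiregularityWeakCriterionK3.lean` (K3 × K-trivial).

## COROLLARY S× (products).  [Markman2025SecantWeilSurvey, Question 11.4, second sentence — negative on abelian `n`-folds, all `n ≥ 3`]

Let `T` be an abelian variety of dimension `m ≥ 0`, `G` a line bundle on `T` (e.g. `𝒪_T`), `Y₀ = J × T`, `F = E ⊠ G`. Then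
(1) `F` satisfies (W) (`ker ob_F = ker ⌟ch(F)` on `HT²(Y₀)`) and (W_T); (2) `F` is not semiregular; (3) along the product family
`𝒴 = 𝒥_B × T → B` (on which `ch(F) = ch(E) ⊗ ch(G)` stays Hodge) `F` has no `B'`-flat deformation for any finite `B' → B`, neither as a
sheaf nor as a twisted sheaf. Hence the second sentence of Question 11.4 has a negative answer on abelian varieties of every dimension
`n = 3 + m ≥ 3` — in particular on the sixfold `J × Ĵ` and on eightfolds `J × T⁵`, the dimensions of the Weil-type ladder. (For SIMPLE
abelian varieties of dimension `≥ 4` the question remains open; the statement is dimension-free, not simplicity-free.)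

PROOF (pen-and-paper; the inputs are [S] and standard Künneth statements). (0) `HT^*(J × T) = HT^*(J) ⊗ HT^*(T)` (`HT^* = ∧^*HT¹`,
`HT¹(J×T) = HT¹(J) ⊕ HT¹(T)`), `Ext^*(E ⊠ G, E ⊠ G) = Ext^*(E,E) ⊗ Ext^*(G,G)`, `HΩ_*(J×T) = HΩ_*(J) ⊗ HΩ_*(T)`, and
`At_{E⊠G} = At_E ⊠ 1 + 1 ⊠ At_G` with commuting summands, so `exp(At_F) = exp(At_E) ⊠ exp(At_G)`, `ch(F) = ch(E) ⊗ ch(G)`,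
`ev_F(u ⊗ u') = ±ev_E(u) ⊗ ev_G(u')` (the algebra map `ev_F : ∧HT¹(J×T) → Ext^*(F,F)` is the tensor product of `ev_E` and `ev_G`: check on
the generators `HT¹(J) ⊗ 1`, `1 ⊗ HT¹(T)` and use multiplicativity [CVdB10]), `(u ⊗ u')⌟ch(F) = ±(u⌟ch E) ⊗ (u'⌟ch G)`, and
`σ_F(α ⊗ β) = σ^{tot}_E(α) ⊗ σ^{tot}_G(β)` (`σ^{tot} = Σ_q tr(At^q ·)/q!`, all components).
(1) On `HT²(J×T) = HT²(J)⊗1 ⊕ HT¹(J)⊗HT¹(T) ⊕ 1⊗HT²(T)` both `ob_F` and `⌟ch(F)` are BLOCK-DIAGONAL, with blocks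
`ob_E ⊗ id_G`, `ev¹_E ⊗ ev¹_G`, `id_E ⊗ ob_G` landing in the distinct Künneth summands `Ext²⊗Hom`, `Ext¹⊗Ext¹`, `Hom⊗Ext²` of `Ext²(F,F)`,
resp. `(⌟chE) ⊗ chG`, `(⌟chE)|_{HT¹} ⊗ (⌟chG)|_{HT¹}`, `chE ⊗ (⌟chG)` landing in `HΩ_{−2}(J)⊗HΩ_0(T)`, `HΩ_{−1}⊗HΩ_{−1}`, `HΩ_0⊗HΩ_{−2}`.
So (W) for `F` is the conjunction of three blockwise kernel equalities (`ker_blocks₃_eq` below): block 1 is (W) for `E` ([S]); block 3 is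
(W) for the line bundle `G`, which is even semiregular (`σ_G(β) = β·e^{c₁(G)}` has first component `β`); block 2: `ev¹_E` and
`(⌟chE)|_{HT¹(J)}` are INJECTIVE — `ev¹_E(β,v) = β·id + v⌟At_E`, whose image in `H⁰(N_{F_e})` is the normal field `v|_{F_e} ≠ 0` for `v ≠ 0`
(`F_e` is irreducible of genus 9, not a translated elliptic curve) while `tr(β·id) = β`; `(β,v)⌟ch(E) = (β; −v⌟[F_e]; …)` with
`v⌟[F_e] = v⌟(L_F²/4) = ½(v⌟L_F)∧L_F ≠ 0` (`L_F` a polarization: `v⌟L_F ≠ 0`, and `∧L_F : H^{0,1} → H^{1,2}` injective by Lefschetz) — and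
`ev¹_G`, `(⌟chG)|_{HT¹(T)}` have the SAME kernel `{(β',v') : β' + v'⌟c₁(G) = 0}` (contraction is a derivation: `v'⌟c₁^k/k! = (v'⌟c₁)c₁^{k−1}/(k−1)!`);
hence both cross kernels equal `HT¹(J) ⊗ ker(ev¹_G)` (`ker_map_eq_of_injective_left` below: over a field, `f, c` injective and `ker g = ker d`
give `ker(f ⊗ g) = ker(c ⊗ d)`). (W_T) is the same computation restricted to `H¹(T_{J×T}) = H¹(T_J)⊗1 ⊕ (H⁰(T_J)⊗H¹(𝒪_T) ⊕ H¹(𝒪_J)⊗H⁰(T_T)) ⊕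
1⊗H¹(T_T)`, using (W_T) for `E` ([S], first order: every direction of `T NL(L_F)` lifts) and the same two facts.
(2) Pick `α ∈ ker σ_E ∖ 0` (`E` is not semiregular, `h⁰(N_{F_e}) = 4 > 3`); `α ⊗ id_G ≠ 0` lies in `Ext²(E,E) ⊗ Hom(G,G) ⊂ Ext²(F,F)` and
`σ_F(α ⊗ id_G) = σ_E(α) ⊗ ch(G) = 0` (for `α ∈ Ext²` on the threefold `J`, `σ^{tot}_E(α) = σ_E(α)`).
(3) Let `ℱ` be a `B'`-flat family (of sheaves) on `𝒴' = (𝒥 ×_B B') × T` with `ℱ_{0'} ≅ E ⊠ G`. Since `ℱ` is flat over `B'` and its fibre over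
`0'` is flat over `T`, `ℱ` is flat over `B' × T` along the (proper) fibre over `{0'} × T` [EGA IV₃ 11.3.10], hence over `B'' × T` for a smaller disc
`B'' ∋ 0'`; so for any `y ∈ T` the restriction `ℱ|_{𝒥'' × {y}}` is a `B''`-flat deformation of `(E ⊠ G)|_{J × {y}} ≅ E` along `B` — contradicting
[S]. A flat family of TWISTED sheaves deforming `F` has rank one, so its Brauer class is trivial on every fibre (a rank-1 twisted sheaf,
torsion-free on a dense open set, trivialises the gerbe generically and `Br` of a smooth variety injects into `Br` of its function field); it is
an honest family after untwisting, and the previous argument applies. ∎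

## What is kernel-checked here (def-free linear algebra and counting)

* `ker_blocks₃_eq` — kernels of block-diagonal maps agree iff they agree blockwise (the reduction of (W) for `F` to the three blocks);
* `ker_map_eq_of_injective_left` — over a field, `f`, `c` injective and `ker g = ker d` ⟹ `ker (f ⊗ g) = ker (c ⊗ d)` (the cross block);
* `HT_two_product_count` — `2·dim HT²(J × T) = 2(3+m)(2(3+m)−1) = 2·(15 + 12m + m(2m−1))` (the three Künneth blocks exhaust `HT²`).
-/

namespace Literature.AlgebraicGeometry.HodgeTheory

open TensorProduct

section Blocks

variable {K : Type*} [Field K]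
variable {A₁ A₂ A₃ X₁ X₂ X₃ Y₁ Y₂ Y₃ : Type*}
variable [AddCommGroup A₁] [Module K A₁] [AddCommGroup A₂] [Module K A₂] [AddCommGroup A₃] [Module K A₃]
variable [AddCommGroup X₁] [Module K X₁] [AddCommGroup X₂] [Module K X₂] [AddCommGroup X₃] [Module K X₃]
variable [AddCommGroup Y₁] [Module K Y₁] [AddCommGroup Y₂] [Module K Y₂] [AddCommGroup Y₃] [Module K Y₃]

/-- **(W) on a product is blockwise.** With `HT²(J × T) = A₁ ⊕ A₂ ⊕ A₃` (Künneth blocks `HT²(J)⊗1`, `HT¹(J)⊗HT¹(T)`, `1⊗HT²(T)`),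
`ob_{E⊠G} = f₁ ⊕ f₂ ⊕ f₃` and `⌟ch(E ⊠ G) = g₁ ⊕ g₂ ⊕ g₃` block-diagonal into distinct Künneth summands, the weak criterion
`ker ob = ker ⌟ch` for `E ⊠ G` follows from the three blockwise equalities. [folklore] -/
theorem ker_blocks₃_eq (f₁ : A₁ →ₗ[K] X₁) (f₂ : A₂ →ₗ[K] X₂) (f₃ : A₃ →ₗ[K] X₃)
    (g₁ : A₁ →ₗ[K] Y₁) (g₂ : A₂ →ₗ[K] Y₂) (g₃ : A₃ →ₗ[K] Y₃)
    (h₁ : LinearMap.ker f₁ = LinearMap.ker g₁) (h₂ : LinearMap.ker f₂ = LinearMap.ker g₂)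
    (h₃ : LinearMap.ker f₃ = LinearMap.ker g₃) :
    LinearMap.ker ((f₁.prodMap f₂).prodMap f₃) = LinearMap.ker ((g₁.prodMap g₂).prodMap g₃) := by
  simp only [LinearMap.ker_prodMap, h₁, h₂, h₃]

end Blocks

section Cross

variable {K : Type*} [Field K]
variable {A B X X' Y Y' : Type*}
variable [AddCommGroup A] [Module K A] [AddCommGroup B] [Module K B]
variable [AddCommGroup X] [Module K X] [AddCommGroup X'] [Module K X']
variable [AddCommGroup Y] [Module K Y] [AddCommGroup Y'] [Module K Y']

/-- Over a field, the kernel of `1_A ⊗ g` depends only on `ker g`. [folklore] -/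
theorem ker_lTensor_eq_of_ker_eq (g : B →ₗ[K] X') (d : B →ₗ[K] Y') (hgd : LinearMap.ker g = LinearMap.ker d) :
    LinearMap.ker (g.lTensor A) = LinearMap.ker (d.lTensor A) := by
  -- factor g = ḡ ∘ mkQ and d = d̄ ∘ mkQ through the common quotient B ⧸ ker g, with ḡ, d̄ injective
  have hd : LinearMap.ker g ≤ LinearMap.ker d := hgd.le
  have fg : g = ((LinearMap.ker g).liftQ g le_rfl).comp (LinearMap.ker g).mkQ := by ext b; simp
  have fd : d = ((LinearMap.ker g).liftQ d hd).comp (LinearMap.ker g).mkQ := by ext b; simp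
  have ig : Function.Injective ((LinearMap.ker g).liftQ g le_rfl) := by
    rw [← LinearMap.ker_eq_bot]; exact Submodule.ker_liftQ_eq_bot _ _ _ le_rfl
  have id' : Function.Injective ((LinearMap.ker g).liftQ d hd) := by
    rw [← LinearMap.ker_eq_bot]; exact Submodule.ker_liftQ_eq_bot _ _ _ hgd.symm.le
  have kg : LinearMap.ker (g.lTensor A) = LinearMap.ker (((LinearMap.ker g).mkQ).lTensor A) := by
    rw [fg, LinearMap.lTensor_comp]
    exact LinearMap.ker_comp_of_ker_eq_bot _
      (LinearMap.ker_eq_bot.mpr (Module.Flat.lTensor_preserves_injective_linearMap _ ig))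
  have kd : LinearMap.ker (d.lTensor A) = LinearMap.ker (((LinearMap.ker g).mkQ).lTensor A) := by
    rw [fd, LinearMap.lTensor_comp]
    exact LinearMap.ker_comp_of_ker_eq_bot _
      (LinearMap.ker_eq_bot.mpr (Module.Flat.lTensor_preserves_injective_linearMap _ id'))
  rw [kg, kd]

/-- **The cross block.** If `f : A → X` and `c : A → Y` are injective (`ev¹_E` and `(⌟ch E)|_{HT¹(J)}` for `E = I_{F_e}`) and
`ker g = ker d` (`ev¹_G` and `(⌟ch G)|_{HT¹(T)}` for a line bundle `G`), then `ker (f ⊗ g) = ker (c ⊗ d)` on `A ⊗ B = HT¹(J) ⊗ HT¹(T)`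
(both equal `A ⊗ ker g`). [folklore] -/
theorem ker_map_eq_of_injective_left (f : A →ₗ[K] X) (c : A →ₗ[K] Y) (g : B →ₗ[K] X') (d : B →ₗ[K] Y')
    (hf : Function.Injective f) (hc : Function.Injective c) (hgd : LinearMap.ker g = LinearMap.ker d) :
    LinearMap.ker (TensorProduct.map f g) = LinearMap.ker (TensorProduct.map c d) := by
  have e1 : TensorProduct.map f g = (f.rTensor X').comp (g.lTensor A) := by
    rw [LinearMap.rTensor_comp_lTensor]
  have e2 : TensorProduct.map c d = (c.rTensor Y').comp (d.lTensor A) := by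
    rw [LinearMap.rTensor_comp_lTensor]
  rw [e1, e2,
    LinearMap.ker_comp_of_ker_eq_bot _
      (LinearMap.ker_eq_bot.mpr (Module.Flat.rTensor_preserves_injective_linearMap _ hf)),
    LinearMap.ker_comp_of_ker_eq_bot _
      (LinearMap.ker_eq_bot.mpr (Module.Flat.rTensor_preserves_injective_linearMap _ hc))]
  exact ker_lTensor_eq_of_ker_eq g d hgd

end Cross

section Count

/-- **Künneth count for `HT²`.** `dim HT²(J × T) = C(2(3+m), 2)` splits as `C(6,2)·1 + 6·2m + C(2m,2) = 15 + 12m + m(2m−1)`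
(blocks `HT²(J)⊗HT⁰(T)`, `HT¹⊗HT¹`, `HT⁰⊗HT²`; `dim HT¹` of an abelian `g`-fold is `2g`). [folklore] -/
theorem HT_two_product_count (m : ℕ) :
    (2 * (3 + m)) * (2 * (3 + m) - 1) = 2 * (15 + 12 * m + m * (2 * m - 1)) := by
  cases m with
  | zero => rfl
  | succ k =>
    have h1 : 2 * (3 + (k + 1)) - 1 = 2 * k + 7 := by omega
    have h2 : 2 * (k + 1) - 1 = 2 * k + 1 := by omega
    rw [h1, h2]
    ring

end Count

end Literature.AlgebraicGeometry.HodgeTheory
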